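import Mathlib

/-!
# chord-idea-2 first-lemma sketches (crux `M3PrimeEdgeSplit.LowerEdge_ge_m4o5`, stmt-Ventures-21721)

Two crux-idea cards of team lb-chord (sparsity = a COST instrument; soundness of any clique-sparse
certificate is already typed in `Cruxes/LowerEdge_ge_m4o5/Lines/clique_sparse_sos.lean`
(`CliqueCertBound`, `blockGram`, `m3Row_of_cliqueCertBound`), which both cards lean on by name).

* `schurEntry_eq_zero_of_disjoint_cliques` — card `schur-fill-clique-covers`: the interior-point
  Schur-complement entry `tr(A · W · B · W)` between two free moment variables whose constraint
  matrices `A`, `B` sit in DIFFERENT clique blocks of the converted cone (block-diagonal scaling `W`)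
  is zero.  This is the whole algebraic content of "clique conversion ⇒ block-arrowhead Schur matrix":
  the IPM memory of a cover is the sparse-Cholesky fill of the free-variable incidence graph, not `16·f²`.
* `segment_support` — card `sparsest-certificate-pattern`: along the segment between two optimal dual
  certificates an entry that differs at the ends vanishes for AT MOST ONE parameter; hence a relative-
  interior (interior-point / maximally complementary) certificate carries the UNION of all optimal
  supports — thresholding it reads what CAN carry dual mass, not what MUST.  The sparsest near-optimal
  certificate is an extreme point of the ε-optimal face and is found by a linear/group-ℓ¹ objective over it.
HONEST FRAMING: nothing here proves a bound or a summit statement; a certified bound is a number with a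
certificate; nothing here predicts superconductivity.
-/

namespace Summit.Ventures.CertifiedManyBodySolver.Cruxes.LowerEdge_ge_m4o5.ChordIdea2

open Matrix

/-- Card `schur-fill-clique-covers`, first lemma.  HKM/NT-type Schur entry `M_{ij} = tr(A_i W A_j W)`:
if `A_i` lives in clique block 1 and `A_j` in clique block 2 of a block-diagonal scaling `W`, then
`M_{ij} = 0`.  (So after clique conversion two free moments interact in the Schur matrix only if some
clique contains both; ordering the clique-private moments first gives a block-arrowhead factorisation.) -/
theorem schurEntry_eq_zero_of_disjoint_cliques {m n : Type*} [Fintype m] [Fintype n]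
    [DecidableEq m] [DecidableEq n]
    (W₁ A₁ : Matrix m m ℝ) (W₂ B₂ : Matrix n n ℝ) :
    Matrix.trace (Matrix.fromBlocks A₁ 0 0 (0 : Matrix n n ℝ) * Matrix.fromBlocks W₁ 0 0 W₂ *
      Matrix.fromBlocks (0 : Matrix m m ℝ) 0 0 B₂ * Matrix.fromBlocks W₁ 0 0 W₂) = 0 := by
  simp [Matrix.fromBlocks_multiply, Matrix.trace]

/-- Card `sparsest-certificate-pattern`, first lemma (scalar form of the relative-interior support
statement).  If the `(i,j)` entries `x ≠ y` of two optimal certificates differ, the entry of the convex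
combination `t·x + (1-t)·y` vanishes for at most one `t`. -/
theorem segment_support (x y t s : ℝ) (hxy : x ≠ y)
    (ht : t * x + (1 - t) * y = 0) (hs : s * x + (1 - s) * y = 0) : s = t := by
  have h1 : (t - s) * (x - y) = 0 := by linear_combination ht - hs
  rcases mul_eq_zero.mp h1 with h2 | h2
  · linarith
  · exact absurd (sub_eq_zero.mp h2) hxy

/-- The object card `sparsest-certificate-pattern` asks the engines to compute, as a bare Prop schema:
an `ε`-optimal certificate whose support (set of Gram couplings it uses) is contained in a pattern `P`.
`dualValue Z` = the certified value of certificate `Z`, `supp Z` its coupling support, `vstar` the dense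
optimum.  The card's falsifier reads the smallest `P` (by cone rows) for which this holds at `ε = 3e-4`. -/
def SparseNearOptimalCert {Cert Entry : Type*} (dualValue : Cert → ℝ) (supp : Cert → Set Entry)
    (vstar ε : ℝ) (P : Set Entry) : Prop :=
  ∃ Z : Cert, vstar - ε ≤ dualValue Z ∧ supp Z ⊆ P

/-- Monotonicity of the schema in the pattern (bigger pattern, easier): the discovered minimal pattern
transfers UPWARD to any cover containing it. -/
theorem sparseNearOptimalCert_mono {Cert Entry : Type*} (dualValue : Cert → ℝ) (supp : Cert → Set Entry)
    (vstar ε : ℝ) {P Q : Set Entry} (hPQ : P ⊆ Q)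
    (h : SparseNearOptimalCert dualValue supp vstar ε P) : SparseNearOptimalCert dualValue supp vstar ε Q := by
  obtain ⟨Z, hv, hP⟩ := h
  exact ⟨Z, hv, hP.trans hPQ⟩

end Summit.Ventures.CertifiedManyBodySolver.Cruxes.LowerEdge_ge_m4o5.ChordIdea2
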